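import Summits.BirchSwinnertonDyer.BirchSwinnertonDyer.Theorems.CumulativeHeegnerLeopoldtCumulativeHeegnerInclusionAtThreeGlue
import Summits.BirchSwinnertonDyer.BirchSwinnertonDyer.Theorems.CumulativeHeegnerLeopoldtResidualSelmerFiniteAtThreeOfPrint
import Summits.BirchSwinnertonDyer.BirchSwinnertonDyer.Theorems.EisensteinPrimesResidualCharacterSelmerFiniteOfFact
import HarnessLib

/-!
# Route `CumulativeHeegnerLeopoldt`, crux K1 `CumulativeHeegnerInclusionAtThree` (stmt-BirchSwinnertonDyer-24198):
# the rev-5 split K1 = A + print is EXACT — K1 ⟹ A outright, and K1 ⟺ A modulo the ONE print input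
# (helper, `--supports stmt-BirchSwinnertonDyer-24198`)

Prover `leafhand-bsd-cumulativeheegnerl-2` g0 (cell `bsd-eis`). Line `birth` v5 of K1 (skeleton 59217cca7adb8cbc) has two
registered stubs: STUB A `stub_temperedInclusion` (= child crux stmt-26896 `TemperedHeegnerInclusionAtThree` VERBATIM,
research) and STUB P `stub_residualCharacterSelmerFinite` (= CGLS 2022 Prop. 14 = route decl
`ResidualSelmerPrintedInputAtThree` BY VALUE). The tree proves K1 ⟸ A ∧ P (glue p615902 + B1P closer p616187) and
K1 ⟸ A ∧ Prop. 1.2.5 (p796841). This file records the converse bookkeeping, so that the partition of K1 into its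
children is certified LOSSLESS in the kernel:

* `temperedHeegnerInclusionAtThree_of_cumulativeHeegnerInclusionAtThree` — K1 ⟹ A with NO input (`μ = 0`);
* `cumulativeHeegnerInclusionAtThree_iff_tempered_of_prop14` — granted Prop. 14 (route decl
  `ResidualSelmerPrintedInputAtThree`), K1 ⟺ A;
* `cumulativeHeegnerInclusionAtThree_iff_tempered_of_prop125` — the same granted CGLS Prop. 1.2.5's module clause instead
  (Prop. 14 ⟸ Prop. 1.2.5 in the kernel, `TeichmullerPairUnramifiedAtMult.prop14_residualCharacterSelmer_finite_of_fact`).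

Reading: on the print ledger of the route ({CGLS Prop. 1.2.5 / Prop. 14}), crux K1 (24198) and crux A (26896) are the SAME
statement; every seat result on either transfers verbatim to the other; no strength is lost in the split.

HONEST FRAMING: bookkeeping compositions of tree theorems; no definition, no named fact introduced, no `sorry`; the
`iff`s are CONDITIONAL on one published fact typed as a `Prop`; items 24198 / 26896 stay OPEN; no stub is closed.
BSD is not proved for any curve.
References: [CastellaGrossiLeeSkinner2022] §1.2 Prop. 1.2.5, Prop. 14; tree p615902, p616187, p796841.
-/

set_option linter.dupNamespace false
set_option autoImplicit false

noncomputable section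

namespace Summit.BirchSwinnertonDyer.BirchSwinnertonDyer.Theorems.CumulativeHeegnerInclusionAtThreeSplitExact

open Summit.BirchSwinnertonDyer.BirchSwinnertonDyer.Theses.CumulativeHeegnerLeopoldt

/-- **K1 ⟹ A, unconditionally**: the full inclusion `span{L} ≤ Ch·R₀⟦T⟧` is the tempered inclusion
`span{3^μ·L} ≤ Ch·R₀⟦T⟧` at `μ = 0`. [cite: CastellaGrossiLeeSkinner2022, §1.2 Prop. 14] -/
theorem temperedHeegnerInclusionAtThree_of_cumulativeHeegnerInclusionAtThree
    (h : CumulativeHeegnerInclusionAtThree) : TemperedHeegnerInclusionAtThree := by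
  intro W _ _ N _ K _ _ Dt hO6 hRed hcell hr hN hK hHg κ hκ γ _ 𝔭 h𝔭 he hf 𝔭' h𝔭' hne ι' hι ΩK Ωp L hΩK hΩp hBDP
  refine ⟨0, ?_⟩
  rw [pow_zero, one_mul]
  exact h W N K Dt hO6 hRed hcell hr hN hK hHg κ hκ γ 𝔭 h𝔭 he hf 𝔭' h𝔭' hne ι' hι ΩK Ωp L hΩK hΩp hBDP

/-- **K1 ⟺ A granted the print input P** (CGLS 2022 Prop. 14, route decl `ResidualSelmerPrintedInputAtThree`):
forward by `μ = 0`, backward by the landed glue of the split (p615902) and the B1P closer (p616187).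
CONDITIONAL on the named fact. [cite: CastellaGrossiLeeSkinner2022, §1.2 Prop. 14] -/
theorem cumulativeHeegnerInclusionAtThree_iff_tempered_of_prop14 (hP : ResidualSelmerPrintedInputAtThree) :
    CumulativeHeegnerInclusionAtThree ↔ TemperedHeegnerInclusionAtThree :=
  ⟨temperedHeegnerInclusionAtThree_of_cumulativeHeegnerInclusionAtThree, fun hA ↦
    cumulativeHeegnerLeopoldt_cumulativeHeegnerInclusionAtThreeGlue_proof hA hP
      cumulativeHeegnerLeopoldt_residualSelmerFiniteAtThreeOfPrint_proof⟩

/-- **K1 ⟺ A granted CGLS 2022 Prop. 1.2.5's module clause** (the print conjunct shared with crux 23970's ALG-PRINT;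
Prop. 14 ⟸ Prop. 1.2.5 in the kernel; the backward direction is the composition of p796841, re-derived here from the glue). CONDITIONAL on the named fact.
[cite: CastellaGrossiLeeSkinner2022, §1.2 Prop. 1.2.5, Prop. 14] -/
theorem cumulativeHeegnerInclusionAtThree_iff_tempered_of_prop125
    (hprop125 :
      Literature.NumberTheory.EllipticCurves.CastellaGrossiLeeSkinner2022.prop125_characterGrSelmerDual_torsion_muZero_dim) :
    CumulativeHeegnerInclusionAtThree ↔ TemperedHeegnerInclusionAtThree :=
  ⟨temperedHeegnerInclusionAtThree_of_cumulativeHeegnerInclusionAtThree, fun hA ↦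
    cumulativeHeegnerLeopoldt_cumulativeHeegnerInclusionAtThreeGlue_proof hA
      (TeichmullerPairUnramifiedAtMult.prop14_residualCharacterSelmer_finite_of_fact hprop125)
      cumulativeHeegnerLeopoldt_residualSelmerFiniteAtThreeOfPrint_proof⟩

end Summit.BirchSwinnertonDyer.BirchSwinnertonDyer.Theorems.CumulativeHeegnerInclusionAtThreeSplitExact

end
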